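import Mathlib
import HarnessLib
import Summits.KontsevichZagierPeriods.KontsevichZagierPeriods.Theorems.LinRedNormalFormDihedralNormalFormStubNestedReductionAux9

/-!
# `DihedralNormalForm`, line `torus-descent-sum-shadow`, stub `stub_nestedReduction` — Aux 10

Support file for the stub `stub_nestedReduction` (THEOREM N) of the crux `DihedralNormalForm`
(stmt-KontsevichZagierPeriods-3912, route `LinRedNormalForm`): **the potentials of the
induction** on prefix-nested exponent data `e` (dimension `m + 1`, prefix chords `[0,j]`):
* `Nested.phi2 e = Σ_{j ≠ 0, e 0 j ≤ −2} (−e 0 j − 1)·2^{m+1−j}` (weighted excess multiplicity,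
  phase (N2)): it drops when the multiplicity of `[0,p]` is lowered, is blind to singleton
  exponents, and rises by at most `2^{m+1−j}` when the exponent of an OUTER chord `[0,j]`, `j > p`,
  is lowered — a net decrease (`Nested.phi2_outer_lt`);
* `Nested.nu e = Σ_{j ≠ 0} (e 0 j)⁺ + Σ_l (e l l)⁺` (phase (N3), peeling numerator factors);
* the passage reduced ↦ simple prefix chain (`Nested.exists_eP_of_reduced`).

References: M. Kontsevich, D. Zagier, *Periods* (2001), §1.2.
-/

namespace Summit.KontsevichZagierPeriods.DihedralNormalForm.TorusDescent

namespace Nested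

open Finset

variable {m : ℕ}

/-! ## Elementary consequences for `α` -/

/-- Raising one exponent keeps all `α ≥ 0`. -/
theorem alphaS_eadd_one_nonneg {k : ℕ} {e : Fin k → Fin k → ℤ}
    (hα : ∀ i j : Fin k, i ≤ j → 0 ≤ alphaS e i j) (a b : Fin k) (i j : Fin k) (hij : i ≤ j) :
    0 ≤ alphaS (eadd e a b 1) i j := by
  rw [alphaS_eadd]
  have := hα i j hij
  split_ifs <;> linarith

/-- Moving one unit of exponent from `[z,p]` to an outer chord `[z,j₀] ⊇ [z,p]` keeps all `α ≥ 0`. -/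
theorem alphaS_outer_nonneg {k : ℕ} {e : Fin k → Fin k → ℤ}
    (hα : ∀ i j : Fin k, i ≤ j → 0 ≤ alphaS e i j) {z p j₀ : Fin k} (hzp : z ≤ p) (hpj : p ≤ j₀)
    (i j : Fin k) (hij : i ≤ j) : 0 ≤ alphaS (eadd (eadd e z p 1) z j₀ (-1)) i j := by
  rw [alphaS_eadd, alphaS_eadd]
  have := hα i j hij
  by_cases h : i ≤ z ∧ z ≤ j₀ ∧ j₀ ≤ j
  · rw [if_pos h, if_pos ⟨h.1, hzp, hpj.trans h.2.2⟩]; linarith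
  · rw [if_neg h]; split_ifs <;> linarith

/-! ## The potential of phase (N2) -/

/-- One term of `phi2`. -/
def phi2t (e : Fin (m + 1) → Fin (m + 1) → ℤ) (j : Fin (m + 1)) : ℕ :=
  if (j : ℕ) ≠ 0 ∧ e 0 j ≤ -2 then (-e 0 j - 1).toNat * 2 ^ (m + 1 - (j : ℕ)) else 0

/-- The weighted excess multiplicity `Σ_{j ≠ 0, e 0 j ≤ −2} (−e 0 j − 1)·2^{m+1−j}`. -/
def phi2 (e : Fin (m + 1) → Fin (m + 1) → ℤ) : ℕ := ∑ j : Fin (m + 1), phi2t e j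

/-- Terms of `phi2` only see the exponent `e 0 j`. -/
theorem phi2t_congr {e e' : Fin (m + 1) → Fin (m + 1) → ℤ} {j : Fin (m + 1)} (h : e' 0 j = e 0 j) :
    phi2t e' j = phi2t e j := by
  simp [phi2t, h]

/-- Lowering the multiplicity of `[0,p]` (`e 0 p ≤ −2 ↦ e 0 p + 1`) lowers `phi2` by `2^{m+1−p}`. -/
theorem phi2_eadd_one {e : Fin (m + 1) → Fin (m + 1) → ℤ} {p : Fin (m + 1)} (hp : (p : ℕ) ≠ 0)
    (he : e 0 p ≤ -2) : phi2 (eadd e 0 p 1) + 2 ^ (m + 1 - (p : ℕ)) = phi2 e := by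
  unfold phi2
  rw [← add_sum_erase _ _ (mem_univ p), ← add_sum_erase _ (phi2t e) (mem_univ p)]
  have hrest : ∑ j ∈ univ.erase p, phi2t (eadd e 0 p 1) j = ∑ j ∈ univ.erase p, phi2t e j :=
    sum_congr rfl fun j hj => phi2t_congr (by simp [eadd_apply, ne_of_mem_erase hj])
  rw [hrest, add_right_comm]
  congr 1
  have hnew : eadd e 0 p 1 0 p = e 0 p + 1 := by simp [eadd_apply]
  simp only [phi2t, hnew, hp, ne_eq, not_false_eq_true, true_and, he, if_true]
  by_cases h2 : e 0 p + 1 ≤ -2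
  · rw [if_pos h2, ← add_one_mul]
    congr 1
    omega
  · rw [if_neg h2, zero_add]
    have h3 : e 0 p = -2 := by omega
    rw [h3]
    simp

/-- Singleton exponents (`p ≠ 0`) are invisible to `phi2`. -/
theorem phi2_eadd_diag (e : Fin (m + 1) → Fin (m + 1) → ℤ) {p : Fin (m + 1)} (hp : (p : ℕ) ≠ 0)
    (c : ℤ) : phi2 (eadd e p p c) = phi2 e := by
  unfold phi2
  refine sum_congr rfl fun j _ => phi2t_congr ?_
  have : (0 : Fin (m + 1)) ≠ p := fun h => hp (by rw [← h]; rfl)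
  simp [eadd_apply, this]

/-- Lowering the exponent of `[0,j₀]` by one raises `phi2` by at most `2^{m+1−j₀}`. -/
theorem phi2_eadd_neg_one_le (e : Fin (m + 1) → Fin (m + 1) → ℤ) {j₀ : Fin (m + 1)}
    (hj₀ : (j₀ : ℕ) ≠ 0) : phi2 (eadd e 0 j₀ (-1)) ≤ phi2 e + 2 ^ (m + 1 - (j₀ : ℕ)) := by
  unfold phi2
  rw [← add_sum_erase _ _ (mem_univ j₀), ← add_sum_erase _ (phi2t e) (mem_univ j₀)]
  have hrest : ∑ j ∈ univ.erase j₀, phi2t (eadd e 0 j₀ (-1)) j = ∑ j ∈ univ.erase j₀, phi2t e j :=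
    sum_congr rfl fun j hj => phi2t_congr (by simp [eadd_apply, ne_of_mem_erase hj])
  rw [hrest, add_assoc, add_comm (∑ j ∈ univ.erase j₀, phi2t e j), ← add_assoc]
  refine Nat.add_le_add_right ?_ _
  have hnew : eadd e 0 j₀ (-1) 0 j₀ = e 0 j₀ - 1 := by simp [eadd_apply]; ring
  simp only [phi2t, hnew, hj₀, ne_eq, not_false_eq_true, true_and]
  by_cases h1 : e 0 j₀ ≤ -2
  · rw [if_pos (by omega), if_pos h1, ← add_one_mul]
    refine Nat.mul_le_mul_right _ (le_of_eq ?_)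
    omega
  · rw [if_neg h1, zero_add]
    by_cases h2 : e 0 j₀ - 1 ≤ -2
    · rw [if_pos h2]
      have h3 : e 0 j₀ = -1 := by omega
      rw [h3]
      simp
    · rw [if_neg h2]
      exact Nat.zero_le _

/-- **The outer byproducts of the Newton–Leibniz step have smaller `phi2`**: lowering the
multiplicity of `[0,p]` and raising that of an outer `[0,j₀]`, `j₀ > p`. -/
theorem phi2_outer_lt {e : Fin (m + 1) → Fin (m + 1) → ℤ} {p j₀ : Fin (m + 1)} (hp : (p : ℕ) ≠ 0)
    (he : e 0 p ≤ -2) (hpj : p < j₀) :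
    phi2 (eadd (eadd e 0 p 1) 0 j₀ (-1)) < phi2 e := by
  have h1 := phi2_eadd_neg_one_le (eadd e 0 p 1) (j₀ := j₀) (by
    have : (p : ℕ) < (j₀ : ℕ) := hpj
    omega)
  have h2 := phi2_eadd_one hp he
  have hlt : 2 ^ (m + 1 - (j₀ : ℕ)) < 2 ^ (m + 1 - (p : ℕ)) := by
    refine Nat.pow_lt_pow_right (by norm_num) ?_
    have hj : (j₀ : ℕ) < m + 1 := j₀.isLt
    have : (p : ℕ) < (j₀ : ℕ) := hpj
    omega
  omega

/-- **The multiplicity-lowered data have smaller `phi2`.** -/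
theorem phi2_eadd_one_lt {e : Fin (m + 1) → Fin (m + 1) → ℤ} {p : Fin (m + 1)} (hp : (p : ℕ) ≠ 0)
    (he : e 0 p ≤ -2) : phi2 (eadd e 0 p 1) < phi2 e := by
  have := phi2_eadd_one hp he
  have : 0 < 2 ^ (m + 1 - (p : ℕ)) := Nat.two_pow_pos _
  omega

/-! ## The potential of phase (N3) -/

/-- The total positive exponent `Σ_{j ≠ 0} (e 0 j)⁺ + Σ_l (e l l)⁺`. -/
def nu (e : Fin (m + 1) → Fin (m + 1) → ℤ) : ℕ :=
  (∑ j : Fin (m + 1), if (j : ℕ) ≠ 0 then (e 0 j).toNat else 0) + ∑ l : Fin (m + 1), (e l l).toNat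

/-- Peeling one power of a numerator kernel chord `[0,j₀]` lowers `nu`. -/
theorem nu_peel_kernel_lt {e : Fin (m + 1) → Fin (m + 1) → ℤ} {j₀ : Fin (m + 1)} (hj₀ : (j₀ : ℕ) ≠ 0)
    (he : 1 ≤ e 0 j₀) : nu (eadd e 0 j₀ (-1)) < nu e := by
  unfold nu
  have hdiag : ∑ l : Fin (m + 1), (eadd e 0 j₀ (-1) l l).toNat = ∑ l : Fin (m + 1), (e l l).toNat := by
    refine sum_congr rfl fun l _ => ?_
    rw [eadd_apply, if_neg, add_zero]
    rintro ⟨h1, h2⟩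
    exact hj₀ (by rw [← h2, h1]; rfl)
  rw [hdiag]
  refine Nat.add_lt_add_right ?_ _
  rw [← add_sum_erase _ _ (mem_univ j₀),
    ← add_sum_erase _ (fun j : Fin (m + 1) => if (j : ℕ) ≠ 0 then (e 0 j).toNat else 0) (mem_univ j₀)]
  have hrest : ∑ j ∈ univ.erase j₀, (if (j : ℕ) ≠ 0 then (eadd e 0 j₀ (-1) 0 j).toNat else 0) =
      ∑ j ∈ univ.erase j₀, (if (j : ℕ) ≠ 0 then (e 0 j).toNat else 0) :=
    sum_congr rfl fun j hj => by simp [eadd_apply, ne_of_mem_erase hj]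
  rw [hrest]
  refine Nat.add_lt_add_right ?_ _
  have hnew : eadd e 0 j₀ (-1) 0 j₀ = e 0 j₀ - 1 := by simp [eadd_apply]; ring
  simp only [hnew, hj₀, ne_eq, not_false_eq_true, if_true]
  omega

/-- Peeling one power of a numerator singleton factor `(1 − x_l)` lowers `nu`. -/
theorem nu_peel_diag_lt {e : Fin (m + 1) → Fin (m + 1) → ℤ} {l₀ : Fin (m + 1)} (he : 1 ≤ e l₀ l₀) :
    nu (eadd e l₀ l₀ (-1)) < nu e := by
  unfold nu
  have hker : ∑ j : Fin (m + 1), (if (j : ℕ) ≠ 0 then (eadd e l₀ l₀ (-1) 0 j).toNat else 0) =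
      ∑ j : Fin (m + 1), (if (j : ℕ) ≠ 0 then (e 0 j).toNat else 0) := by
    refine sum_congr rfl fun j _ => ?_
    by_cases hj : (j : ℕ) ≠ 0
    · rw [if_pos hj, if_pos hj, eadd_apply, if_neg, add_zero]
      rintro ⟨h1, h2⟩
      exact hj (by rw [h2, ← h1]; rfl)
    · rw [if_neg hj, if_neg hj]
  rw [hker]
  refine Nat.add_lt_add_left ?_ _
  rw [← add_sum_erase _ _ (mem_univ l₀), ← add_sum_erase _ (fun l => (e l l).toNat) (mem_univ l₀)]
  have hrest : ∑ l ∈ univ.erase l₀, (eadd e l₀ l₀ (-1) l l).toNat = ∑ l ∈ univ.erase l₀, (e l l).toNat :=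
    sum_congr rfl fun l hl => by simp [eadd_apply, ne_of_mem_erase hl]
  rw [hrest]
  refine Nat.add_lt_add_right ?_ _
  have hnew : eadd e l₀ l₀ (-1) l₀ l₀ = e l₀ l₀ - 1 := by simp [eadd_apply]; ring
  rw [hnew]
  omega

/-! ## From reduced data to simple prefix chains -/

/-- **Reduced data without numerator factors are simple prefix chains** (on the chords `i ≤ j`
that the atom integrand reads). -/
theorem exists_eP_of_reduced {e : Fin (m + 1) → Fin (m + 1) → ℤ}
    (hPN : ∀ i j : Fin (m + 1), i < j → e i j ≠ 0 → (i : ℕ) = 0)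
    (hker : ∀ i j : Fin (m + 1), i < j → -1 ≤ e i j) (hdiag : ∀ l : Fin (m + 1), 0 ≤ e l l)
    (hnu : nu e = 0) :
    ∃ P : Finset (Fin (m + 1)), (0 : Fin (m + 1)) ∉ P ∧ ∀ i j : Fin (m + 1), i ≤ j → e i j = eP P i j := by
  have hnu' := hnu
  unfold nu at hnu'
  rw [Nat.add_eq_zero_iff] at hnu'
  have hk0 : ∀ j : Fin (m + 1), (j : ℕ) ≠ 0 → e 0 j ≤ 0 := by
    intro j hj
    have := (sum_eq_zero_iff.mp hnu'.1) j (mem_univ j)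
    rw [if_pos hj] at this
    omega
  have hd0 : ∀ l : Fin (m + 1), e l l = 0 := fun l => by
    have := (sum_eq_zero_iff.mp hnu'.2) l (mem_univ l)
    have := hdiag l
    omega
  refine ⟨univ.filter fun j => (j : ℕ) ≠ 0 ∧ e 0 j = -1, by simp, fun i j hij => ?_⟩
  rw [eP_apply]
  rcases eq_or_lt_of_le hij with rfl | hlt
  · rw [hd0, if_neg]
    rintro ⟨h1, h2⟩
    rw [mem_filter] at h2
    exact h2.2.1 h1
  · by_cases h0 : e i j = 0
    · rw [h0, if_neg]
      rintro ⟨h1, h2⟩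
      rw [mem_filter] at h2
      have hi0 : i = 0 := Fin.ext h1
      rw [hi0] at h0
      rw [h0] at h2
      norm_num at h2
    · have h1 := hPN i j hlt h0
      have hi0 : i = 0 := Fin.ext h1
      subst hi0
      have hj : (j : ℕ) ≠ 0 := by
        intro hj
        have : j = 0 := Fin.ext hj
        rw [this] at hlt
        exact lt_irrefl _ hlt
      have h2 := hk0 j hj
      have h3 := hker 0 j hlt
      have h4 : e 0 j = -1 := by omega
      rw [h4, if_pos ⟨rfl, mem_filter.mpr ⟨mem_univ _, hj, h4⟩⟩]

end Nested

/-- **Registered sub-goal `stub_nestedReductionAux10`**: moving one unit of exponent from a chord to an outer chord keeps the convergence criterion (`Nested.alphaS_outer_nonneg`). -/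
theorem stub_nestedReductionAux10 : ∀ (k : ℕ) (e : Fin k → Fin k → ℤ), (∀ i j : Fin k, i ≤ j → 0 ≤ ((j : ℤ) - (i : ℤ)) + ∑ i' : Fin k, ∑ j' : Fin k, if i ≤ i' ∧ i' ≤ j' ∧ j' ≤ j then e i' j' else 0) → ∀ (z p j₀ : Fin k), z ≤ p → p ≤ j₀ → ∀ i j : Fin k, i ≤ j → 0 ≤ ((j : ℤ) - (i : ℤ)) + ∑ i' : Fin k, ∑ j' : Fin k, if i ≤ i' ∧ i' ≤ j' ∧ j' ≤ j then ((e i' j' + if i' = z ∧ j' = p then 1 else 0) + if i' = z ∧ j' = j₀ then -1 else 0) else 0 :=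
  fun _ _ hα _ _ _ hzp hpj i j hij =>
    Nested.alphaS_outer_nonneg hα hzp hpj i j hij

end Summit.KontsevichZagierPeriods.DihedralNormalForm.TorusDescent
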